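import Mathlib
import Summits.Ventures.FusionMHD.Models.FluxSurfacePolarRayGlue
import HarnessLib

/-!
# Polar-ray TUBE GLUE: the glued ray radius located in a tube `|ρ(θ) − m(θ)| < r` around ANY continuous approximant `m` from a
# residual bound and a slope bound, and the panel integral of the TRUE integrand bracketed by `∫ₐᵇ Φ(θ, m θ) dθ ∓ E(b − a)` —
# the «non-mechanical piece» of a certified `q` on a shaped flux surface, in the vocabulary of the Taylor-model program lane

LADDER-GRIDFUSION (F2 item R2; consumer = the WAVE-1 item «certified interior q(ψ_N)/F of THE CF ITER-like instance» scoped by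
gridfusion-model-5 in `pub/gridfusion/models/F2-SCOPING.md` v1.4 §8(b)/(c): Newton-in-the-program `TProg` integrand, certificate shape
(1) integral certificate of the explicit program integrand `g(θ) = Φ(θ, ρ₂(θ))`, (2) residual sup-bound `|U(γ_{ρ₂}(θ)) − c| ≤ η`, (3) slope
bound `D_r ≥ μ` on the tube `|s − ρ₂| ≤ r`, (4) `|∂_s g| ≤ L` on the tube, (5) glue to `GradShafranov.safetyFactorE` — «the only non-mechanical
piece is the continuity/measurability of the implicit radius θ ↦ ρ(θ) in the tube (model-7's rayRadius glue …)»).  THIS FILE IS THAT PIECE,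
stated once for every surface and every approximant: cell `gridfusion`, seat `gridfusion-model-7` (g3), 2026-08-27; companion of
`Models/FluxSurfacePolarRayGlue.lean` (p533734; `rayRadius`, `rayRadius_spec`, `continuousOn_rayRadius`, `polarIntegrand`,
`continuousOn_polarIntegrand`).  Elementary real analysis, [folklore]; 0 kit; no equilibrium, no device; NOT a certificate.

WHAT IS PROVED (arbitrary `ψ`, centre `(R_c, Z_c)`, level `u`; `ρ := rayRadius ψ R_c Z_c u`; the glue's COARSE panel hypotheses on
`[a, b] × [s₁, s₂]` — `hin` profile `< u` on `(0, s₁]`, `hF` joint continuity, `hmono` strictly increasing on the bracket, `hout` `> u` at `s₂`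
— supply uniqueness in `(0, s₂]`, continuity and integrability ONCE per coarse region; everything below refines the location inside it):
* §1 `rayRadius_mem_Ioo_of_signs(_on)`: test radii `s₁ ≤ ℓ₁ ≤ ℓ₂ ≤ s₂` (numbers or functions of `θ`) with `ψ(ray ℓ₁) < u < ψ(ray ℓ₂)` ⇒
  `ρ(θ) ∈ (ℓ₁, ℓ₂)`.  §1b `signs_of_residual_of_slope` (one variable, mean value): `|F(m₀) − u| ≤ η`, `F′ ≥ μ > 0` on `[m₀ − r, m₀ + r]`,
  `rμ > η` ⇒ `F(m₀ − r) < u < F(m₀ + r)`; hence **`rayRadius_mem_tube`**: a RESIDUAL bound `|ψ(ray_θ m(θ)) − u| ≤ η` (§8(b) step (2)) and a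
  SLOPE bound `∂_sψ(ray_θ s) = D(θ, s) ≥ μ` on `|s − m(θ)| ≤ r` (step (3)) with `rμ > η` give `|ρ(θ) − m(θ)| < r` — for ANY approximant `m`
  (the program's Newton iterate `ρ₂`, left opaque; an interpolant; an affine test radius).
* §2 `polarKernel R_c D θ s := s/((R_c + s cos θ)·D(θ, s))` — the EXPLICIT kernel; `polarIntegrand = polarKernel ∘ (θ, ρ θ)` (`rfl`);
  `panel_integral_envelope`: a pointwise envelope `g⁻ θ ≤ Φ(θ, s) ≤ g⁺ θ` on a tube `s ∈ [ℓ₁ θ, ℓ₂ θ] ∋ ρ(θ)`, `g±` integrable ⇒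
  `∫ₐᵇ g⁻ ≤ ∫ₐᵇ ρ/(R·D) ≤ ∫ₐᵇ g⁺`; `panel_integral_midline`: midline `m`, half-width `η′`, `|Φ(θ, s) − Φ(θ, mθ)| ≤ E` on the tube ⇒
  `|∫ₐᵇ ρ/(R·D) dθ − ∫ₐᵇ Φ(θ, mθ) dθ| ≤ E(b − a)`.
* §3 **`panel_integral_tube`** — steps (2)+(3)+(4) ⇒ the bracket, in one statement: coarse hypotheses + `m` with `[m − r, m + r] ⊆ [s₁, s₂]`
  on the panel + residual `≤ η` + slope `≥ μ` (as `HasDerivAt (s ↦ ψ(ray_θ s)) (D θ s) s`, the shape panel files certify) + `rμ > η` + tube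
  Lipschitz bound `E` + `θ ↦ Φ(θ, m θ)` integrable ⇒ `∫ₐᵇ Φ(θ, mθ) dθ − E(b − a) ≤ ∫ₐᵇ ρ/(R·D) dθ ≤ ∫ₐᵇ Φ(θ, mθ) dθ + E(b − a)`; combine with the
  lane's `integral_bounds_of_certCheckT` for `∫ₐᵇ Φ(θ, mθ)` (step (1)) and sum panels with the glue's `sum_panel_bounds`; step (5) is #88's
  `safetyFactorE_eq_polar` for the glued `ρ` (`FluxSurfacePolarRayLoop.safetyFactorE_eq_polar_rayRadius`, D = D_r by `radialDeriv_eq_of_hasDerivAt`).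
WHY THE TUBE AND NOT THE BRACKET sets the error: the glue's zeroth-order bracket `(b − a)s₁/(R⁺d⁺) ≤ ∫ ≤ (b − a)s₂/(R⁻d⁻)` has relative width
`≥ osc_{[a,b]} ρ/ρ ≈ |ρ′|h/ρ` — first order in the panel width (SIZED-ASK line of record: ≈ 250 panels ⇒ ± 1.5 %); here the error is `E(b − a)`
with `E = L·r`, `r ≈ η/μ` the RESIDUAL of the approximant, independent of `h`.  MODELLED: nothing.  NOT CLAIMED: any value for any equilibrium.
-/

noncomputable section

open Real Set MeasureTheory intervalIntegral Filter Topology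

namespace Summit.Ventures.FusionMHD.Models

namespace PolarRay

section sloped

variable {ψ : ℝ → ℝ → ℝ} {Rc Zc u a b s₁ s₂ : ℝ}

/-- **SLOPED BRACKET, POINTWISE.**  Under the (coarse) panel hypotheses on `[a, b] × [s₁, s₂]`, two test radii
`s₁ ≤ ℓ₁ ≤ ℓ₂ ≤ s₂` at the direction `θ` with `ψ(ray ℓ₁) < u < ψ(ray ℓ₂)` locate the glued radius: `ρ(θ) ∈ (ℓ₁, ℓ₂)`.
(The coarse bracket supplies uniqueness/monotonicity once per surface region; the test radii may depend on `θ` — in a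
certificate `ℓᵢ = mθ + cᵢ` are straight lines hugging the surface, so the tube width is `O(h²)`, not `O(h)`.) [folklore] -/
theorem rayRadius_mem_Ioo_of_signs
    (hF : ContinuousOn (fun p : ℝ × ℝ => rayProfile ψ Rc Zc p.1 p.2) (Icc a b ×ˢ Icc s₁ s₂)) (hs₁ : 0 < s₁) (hs : s₁ ≤ s₂)
    (hin : ∀ θ ∈ Icc a b, ∀ s, 0 < s → s ≤ s₁ → rayProfile ψ Rc Zc θ s < u)
    (hmono : ∀ θ ∈ Icc a b, StrictMonoOn (rayProfile ψ Rc Zc θ) (Icc s₁ s₂))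
    (hout : ∀ θ ∈ Icc a b, u < rayProfile ψ Rc Zc θ s₂)
    {θ : ℝ} (hθ : θ ∈ Icc a b) {l₁ l₂ : ℝ} (hl₁ : s₁ ≤ l₁) (hl : l₁ ≤ l₂) (hl₂ : l₂ ≤ s₂)
    (hlow : rayProfile ψ Rc Zc θ l₁ < u) (hupp : u < rayProfile ψ Rc Zc θ l₂) :
    rayRadius ψ Rc Zc u θ ∈ Ioo l₁ l₂ := by
  have hcontθ : ContinuousOn (rayProfile ψ Rc Zc θ) (Icc s₁ s₂) := by
    have hmap : MapsTo (fun s : ℝ => ((θ, s) : ℝ × ℝ)) (Icc s₁ s₂) (Icc a b ×ˢ Icc s₁ s₂) := fun s hs' => ⟨hθ, hs'⟩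
    exact hF.comp (Continuous.prodMk continuous_const continuous_id).continuousOn hmap
  obtain ⟨hρI, hρu, -⟩ := rayRadius_spec hs₁ hs (hin θ hθ) hcontθ (hmono θ hθ) (hout θ hθ)
  set ρ := rayRadius ψ Rc Zc u θ
  have hm := hmono θ hθ
  have hρmem : ρ ∈ Icc s₁ s₂ := ⟨hρI.1.le, hρI.2.le⟩
  have hl₁mem : l₁ ∈ Icc s₁ s₂ := ⟨hl₁, hl.trans hl₂⟩
  have hl₂mem : l₂ ∈ Icc s₁ s₂ := ⟨hl₁.trans hl, hl₂⟩
  constructor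
  · by_contra hle
    have h := hm.monotoneOn hρmem hl₁mem (not_lt.1 hle)
    rw [hρu] at h
    exact absurd hlow (not_lt.2 h)
  · by_contra hle
    have h := hm.monotoneOn hl₂mem hρmem (not_lt.1 hle)
    rw [hρu] at h
    exact absurd hupp (not_lt.2 h)

/-- **SLOPED BRACKET ON A PANEL**: with continuous (in a certificate: affine) test-radius functions `ℓ₁ ≤ ℓ₂` inside the coarse
bracket and the two sign facts at every `θ ∈ [a, b]`, `ρ(θ) ∈ (ℓ₁ θ, ℓ₂ θ)` on the panel. [folklore] -/
theorem rayRadius_mem_Ioo_of_signs_on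
    (hF : ContinuousOn (fun p : ℝ × ℝ => rayProfile ψ Rc Zc p.1 p.2) (Icc a b ×ˢ Icc s₁ s₂)) (hs₁ : 0 < s₁) (hs : s₁ ≤ s₂)
    (hin : ∀ θ ∈ Icc a b, ∀ s, 0 < s → s ≤ s₁ → rayProfile ψ Rc Zc θ s < u)
    (hmono : ∀ θ ∈ Icc a b, StrictMonoOn (rayProfile ψ Rc Zc θ) (Icc s₁ s₂))
    (hout : ∀ θ ∈ Icc a b, u < rayProfile ψ Rc Zc θ s₂)
    {ℓ₁ ℓ₂ : ℝ → ℝ} (hℓ : ∀ θ ∈ Icc a b, s₁ ≤ ℓ₁ θ ∧ ℓ₁ θ ≤ ℓ₂ θ ∧ ℓ₂ θ ≤ s₂)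
    (hsign : ∀ θ ∈ Icc a b, rayProfile ψ Rc Zc θ (ℓ₁ θ) < u ∧ u < rayProfile ψ Rc Zc θ (ℓ₂ θ))
    {θ : ℝ} (hθ : θ ∈ Icc a b) : rayRadius ψ Rc Zc u θ ∈ Ioo (ℓ₁ θ) (ℓ₂ θ) :=
  rayRadius_mem_Ioo_of_signs hF hs₁ hs hin hmono hout hθ (hℓ θ hθ).1 (hℓ θ hθ).2.1 (hℓ θ hθ).2.2
    (hsign θ hθ).1 (hsign θ hθ).2


/-- **RESIDUAL + SLOPE ⇒ SIGNS** (one real variable, mean value theorem).  If `|F(m₀) − u| ≤ η`, `F` has derivative `F′(s) ≥ μ > 0` at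
every point of `[m₀ − r, m₀ + r]`, and `rμ > η`, then `F(m₀ − r) < u < F(m₀ + r)`. [folklore] -/
theorem signs_of_residual_of_slope {F F' : ℝ → ℝ} {m₀ r η μ u : ℝ} (hr : 0 < r) (hrμ : η < r * μ)
    (hres : |F m₀ - u| ≤ η) (hderiv : ∀ s ∈ Icc (m₀ - r) (m₀ + r), HasDerivAt F (F' s) s)
    (hslope : ∀ s ∈ Icc (m₀ - r) (m₀ + r), μ ≤ F' s) :
    F (m₀ - r) < u ∧ u < F (m₀ + r) := by
  have hcont : ContinuousOn F (Icc (m₀ - r) (m₀ + r)) := fun s hs => (hderiv s hs).continuousAt.continuousWithinAt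
  have hdiff : DifferentiableOn ℝ F (interior (Icc (m₀ - r) (m₀ + r))) := by
    rw [interior_Icc]; exact fun s hs => (hderiv s (Ioo_subset_Icc_self hs)).differentiableAt.differentiableWithinAt
  have hge : ∀ s ∈ interior (Icc (m₀ - r) (m₀ + r)), μ ≤ deriv F s := by
    rw [interior_Icc]; intro s hs; rw [(hderiv s (Ioo_subset_Icc_self hs)).deriv]; exact hslope s (Ioo_subset_Icc_self hs)
  have hmv := (convex_Icc (m₀ - r) (m₀ + r)).mul_sub_le_image_sub_of_le_deriv hcont hdiff hge
  have hm₀ : m₀ ∈ Icc (m₀ - r) (m₀ + r) := ⟨by linarith, by linarith⟩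
  have h1 := hmv (m₀ - r) ⟨le_rfl, by linarith⟩ m₀ hm₀ (by linarith)
  have h2 := hmv m₀ hm₀ (m₀ + r) ⟨by linarith, le_rfl⟩ (by linarith)
  have hres' := abs_le.1 hres
  constructor <;> nlinarith [hres'.1, hres'.2]

/-- **THE GLUED RADIUS LIES IN THE TUBE** (`|ρ(θ) − m(θ)| < r` on the panel): coarse panel hypotheses, an approximant `m` with
`[m(θ) − r, m(θ) + r] ⊆ [s₁, s₂]`, a RESIDUAL bound `|ψ(ray_θ m(θ)) − u| ≤ η`, a SLOPE bound `∂_sψ(ray_θ s) = D(θ, s) ≥ μ` on the tube, and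
`rμ > η`.  (F2-SCOPING §8(b) steps (2)+(3); `m` = the program's Newton iterate, left opaque.) [folklore] -/
theorem rayRadius_mem_tube {r η μ : ℝ} {m : ℝ → ℝ} {D : ℝ → ℝ → ℝ}
    (hF : ContinuousOn (fun p : ℝ × ℝ => rayProfile ψ Rc Zc p.1 p.2) (Icc a b ×ˢ Icc s₁ s₂)) (hs₁ : 0 < s₁) (hs : s₁ ≤ s₂)
    (hin : ∀ θ ∈ Icc a b, ∀ s, 0 < s → s ≤ s₁ → rayProfile ψ Rc Zc θ s < u)
    (hmono : ∀ θ ∈ Icc a b, StrictMonoOn (rayProfile ψ Rc Zc θ) (Icc s₁ s₂))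
    (hout : ∀ θ ∈ Icc a b, u < rayProfile ψ Rc Zc θ s₂)
    (hr : 0 < r) (hrμ : η < r * μ) (hm : ∀ θ ∈ Icc a b, s₁ ≤ m θ - r ∧ m θ + r ≤ s₂)
    (hres : ∀ θ ∈ Icc a b, |rayProfile ψ Rc Zc θ (m θ) - u| ≤ η)
    (hslope : ∀ θ ∈ Icc a b, ∀ s ∈ Icc (m θ - r) (m θ + r), HasDerivAt (rayProfile ψ Rc Zc θ) (D θ s) s ∧ μ ≤ D θ s)
    {θ : ℝ} (hθ : θ ∈ Icc a b) : rayRadius ψ Rc Zc u θ ∈ Ioo (m θ - r) (m θ + r) := by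
  have hsg := signs_of_residual_of_slope (F := rayProfile ψ Rc Zc θ) (F' := D θ) hr hrμ (hres θ hθ)
    (fun s hs' => (hslope θ hθ s hs').1) (fun s hs' => (hslope θ hθ s hs').2)
  exact rayRadius_mem_Ioo_of_signs hF hs₁ hs hin hmono hout hθ (hm θ hθ).1 (by linarith) (hm θ hθ).2 hsg.1 hsg.2

end sloped

/-! ## The envelope form of the panel integral bracket -/

section envelope

variable {ψ : ℝ → ℝ → ℝ} {Rc Zc u a b s₁ s₂ : ℝ}

/-- The EXPLICIT polar kernel `Φ(θ, s) := s/((R_c + s cos θ)·D(θ, s))`, of which the glue's `polarIntegrand` is the value along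
the glued radius: `polarIntegrand θ = Φ(θ, ρ(θ))` (`polarIntegrand_eq_polarKernel`). [folklore] -/
def polarKernel (Rc : ℝ) (D : ℝ → ℝ → ℝ) (θ s : ℝ) : ℝ := s / ((Rc + s * cos θ) * D θ s)

/-- `polarIntegrand ψ R_c Z_c u D θ = polarKernel R_c D θ (ρ θ)`. [folklore] -/
theorem polarIntegrand_eq_polarKernel (D : ℝ → ℝ → ℝ) (θ : ℝ) :
    polarIntegrand ψ Rc Zc u D θ = polarKernel Rc D θ (rayRadius ψ Rc Zc u θ) := rfl

/-- **ENVELOPE ⇒ PANEL INTEGRAL BRACKET.**  Under the coarse panel hypotheses (which make `θ ↦ ρ(θ)/(R·D)` continuous on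
`[a, b]`, hence integrable — glue §2–§3), a sloped tube `ρ(θ) ∈ (ℓ₁ θ, ℓ₂ θ)` and a pointwise ENVELOPE of the explicit kernel on
the tube, `g⁻ θ ≤ Φ(θ, s) ≤ g⁺ θ` for `s ∈ [ℓ₁ θ, ℓ₂ θ]`, with `g±` integrable, give `∫ₐᵇ g⁻ ≤ ∫ₐᵇ ρ/(R·D) dθ ≤ ∫ₐᵇ g⁺`.
In a certificate `g± = Φ(θ, m θ) ± E` with `m` the tube's midline and `E = sup|∂_sΦ|·(half-width)`, and `∫ₐᵇ Φ(θ, m θ) dθ` is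
enclosed by a certified quadrature of an EXPLICIT integrand — the tube width, not the panel width, sets the error. [folklore] -/
theorem panel_integral_envelope {dlo dhi Rlo Rhi : ℝ} {D : ℝ → ℝ → ℝ} {ℓ₁ ℓ₂ glo ghi : ℝ → ℝ}
    (hF : ContinuousOn (fun p : ℝ × ℝ => rayProfile ψ Rc Zc p.1 p.2) (Icc a b ×ˢ Icc s₁ s₂))
    (hDc : ContinuousOn (fun p : ℝ × ℝ => D p.1 p.2) (Icc a b ×ˢ Icc s₁ s₂)) (hab : a ≤ b) (hs₁ : 0 < s₁) (hs : s₁ ≤ s₂)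
    (hin : ∀ θ ∈ Icc a b, ∀ s, 0 < s → s ≤ s₁ → rayProfile ψ Rc Zc θ s < u)
    (hmono : ∀ θ ∈ Icc a b, StrictMonoOn (rayProfile ψ Rc Zc θ) (Icc s₁ s₂))
    (hout : ∀ θ ∈ Icc a b, u < rayProfile ψ Rc Zc θ s₂)
    (hdlo : 0 < dlo) (hD : ∀ θ ∈ Icc a b, ∀ s ∈ Icc s₁ s₂, dlo ≤ D θ s ∧ D θ s ≤ dhi)
    (hRlo : 0 < Rlo) (hR : ∀ θ ∈ Icc a b, ∀ s ∈ Icc s₁ s₂, Rlo ≤ Rc + s * cos θ ∧ Rc + s * cos θ ≤ Rhi)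
    (hℓ : ∀ θ ∈ Icc a b, s₁ ≤ ℓ₁ θ ∧ ℓ₁ θ ≤ ℓ₂ θ ∧ ℓ₂ θ ≤ s₂)
    (hsign : ∀ θ ∈ Icc a b, rayProfile ψ Rc Zc θ (ℓ₁ θ) < u ∧ u < rayProfile ψ Rc Zc θ (ℓ₂ θ))
    (henv : ∀ θ ∈ Icc a b, ∀ s ∈ Icc (ℓ₁ θ) (ℓ₂ θ), glo θ ≤ polarKernel Rc D θ s ∧ polarKernel Rc D θ s ≤ ghi θ)
    (hglo : IntervalIntegrable glo volume a b) (hghi : IntervalIntegrable ghi volume a b) :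
    (∫ θ in a..b, glo θ) ≤ ∫ θ in a..b, polarIntegrand ψ Rc Zc u D θ
      ∧ ∫ θ in a..b, polarIntegrand ψ Rc Zc u D θ ≤ ∫ θ in a..b, ghi θ := by
  have hc := continuousOn_polarIntegrand hF hDc hs₁ hs hin hmono hout hdlo hD hRlo hR
  have hint : IntervalIntegrable (polarIntegrand ψ Rc Zc u D) volume a b :=
    (hc.mono (by rw [uIcc_of_le hab])).intervalIntegrable
  have hpt : ∀ θ ∈ Icc a b, glo θ ≤ polarIntegrand ψ Rc Zc u D θ ∧ polarIntegrand ψ Rc Zc u D θ ≤ ghi θ := by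
    intro θ hθ
    have hρ := rayRadius_mem_Ioo_of_signs_on hF hs₁ hs hin hmono hout hℓ hsign hθ
    rw [polarIntegrand_eq_polarKernel]
    exact henv θ hθ _ ⟨hρ.1.le, hρ.2.le⟩
  exact ⟨intervalIntegral.integral_mono_on hab hglo hint fun θ hθ => (hpt θ hθ).1,
    intervalIntegral.integral_mono_on hab hint hghi fun θ hθ => (hpt θ hθ).2⟩

/-- **MIDLINE FORM.**  The envelope most certificates use: a midline `m` with `ℓ₁ = m − η`, `ℓ₂ = m + η` and a Lipschitz-type
bound `|Φ(θ, s) − Φ(θ, m θ)| ≤ E` on the tube give `∫ₐᵇ Φ(θ, mθ) dθ − E(b − a) ≤ ∫ₐᵇ ρ/(R·D) ≤ ∫ₐᵇ Φ(θ, mθ) dθ + E(b − a)`;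
combine with any certified enclosure `I⁻ ≤ ∫ₐᵇ Φ(θ, mθ) dθ ≤ I⁺`. [folklore] -/
theorem panel_integral_midline {dlo dhi Rlo Rhi E η : ℝ} {D : ℝ → ℝ → ℝ} {m : ℝ → ℝ}
    (hF : ContinuousOn (fun p : ℝ × ℝ => rayProfile ψ Rc Zc p.1 p.2) (Icc a b ×ˢ Icc s₁ s₂))
    (hDc : ContinuousOn (fun p : ℝ × ℝ => D p.1 p.2) (Icc a b ×ˢ Icc s₁ s₂)) (hab : a ≤ b) (hs₁ : 0 < s₁) (hs : s₁ ≤ s₂)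
    (hin : ∀ θ ∈ Icc a b, ∀ s, 0 < s → s ≤ s₁ → rayProfile ψ Rc Zc θ s < u)
    (hmono : ∀ θ ∈ Icc a b, StrictMonoOn (rayProfile ψ Rc Zc θ) (Icc s₁ s₂))
    (hout : ∀ θ ∈ Icc a b, u < rayProfile ψ Rc Zc θ s₂)
    (hdlo : 0 < dlo) (hD : ∀ θ ∈ Icc a b, ∀ s ∈ Icc s₁ s₂, dlo ≤ D θ s ∧ D θ s ≤ dhi)
    (hRlo : 0 < Rlo) (hR : ∀ θ ∈ Icc a b, ∀ s ∈ Icc s₁ s₂, Rlo ≤ Rc + s * cos θ ∧ Rc + s * cos θ ≤ Rhi)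
    (hη : 0 ≤ η) (hm : ∀ θ ∈ Icc a b, s₁ ≤ m θ - η ∧ m θ + η ≤ s₂)
    (hsign : ∀ θ ∈ Icc a b, rayProfile ψ Rc Zc θ (m θ - η) < u ∧ u < rayProfile ψ Rc Zc θ (m θ + η))
    (hE : ∀ θ ∈ Icc a b, ∀ s ∈ Icc (m θ - η) (m θ + η), |polarKernel Rc D θ s - polarKernel Rc D θ (m θ)| ≤ E)
    (hmid : IntervalIntegrable (fun θ => polarKernel Rc D θ (m θ)) volume a b) :
    (∫ θ in a..b, polarKernel Rc D θ (m θ)) - E * (b - a) ≤ ∫ θ in a..b, polarIntegrand ψ Rc Zc u D θ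
      ∧ ∫ θ in a..b, polarIntegrand ψ Rc Zc u D θ ≤ (∫ θ in a..b, polarKernel Rc D θ (m θ)) + E * (b - a) := by
  have hℓ : ∀ θ ∈ Icc a b, s₁ ≤ m θ - η ∧ m θ - η ≤ m θ + η ∧ m θ + η ≤ s₂ :=
    fun θ hθ => ⟨(hm θ hθ).1, by linarith, (hm θ hθ).2⟩
  have henv : ∀ θ ∈ Icc a b, ∀ s ∈ Icc (m θ - η) (m θ + η),
      polarKernel Rc D θ (m θ) - E ≤ polarKernel Rc D θ s ∧ polarKernel Rc D θ s ≤ polarKernel Rc D θ (m θ) + E := by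
    intro θ hθ s hs'
    have h := abs_le.1 (hE θ hθ s hs')
    constructor <;> linarith [h.1, h.2]
  have h := panel_integral_envelope hF hDc hab hs₁ hs hin hmono hout hdlo hD hRlo hR hℓ hsign henv
    (hmid.sub intervalIntegrable_const) (hmid.add intervalIntegrable_const)
  rw [intervalIntegral.integral_sub hmid intervalIntegrable_const, intervalIntegral.integral_add hmid intervalIntegrable_const,
    intervalIntegral.integral_const, smul_eq_mul] at h
  constructor <;> linarith [h.1, h.2]

end envelope

/-! ## §3 One statement in the certificate vocabulary: residual + slope + tube Lipschitz bound ⇒ the panel bracket -/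

section tube

variable {ψ : ℝ → ℝ → ℝ} {Rc Zc u a b s₁ s₂ : ℝ}

/-- **PANEL BRACKET FROM TUBE FACTS** (F2-SCOPING §8(b) steps (2)+(3)+(4) ⇒ the bracket of the TRUE polar integral): under the coarse
panel hypotheses (with the glue's `D`- and `R`-bounds on the coarse box, which make the true integrand continuous), an approximant `m` with
`[m − r, m + r] ⊆ [s₁, s₂]` on the panel, residual `|ψ(ray_θ m θ) − u| ≤ η`, slope `D ≥ μ` on the tube with `rμ > η`, and the tube bound
`|Φ(θ, s) − Φ(θ, m θ)| ≤ E` for `|s − m θ| ≤ r`:  `|∫ₐᵇ ρ/(R·D) dθ − ∫ₐᵇ Φ(θ, m θ) dθ| ≤ E·(b − a)`. [folklore] -/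
theorem panel_integral_tube {dlo dhi Rlo Rhi E r η μ : ℝ} {D : ℝ → ℝ → ℝ} {m : ℝ → ℝ}
    (hF : ContinuousOn (fun p : ℝ × ℝ => rayProfile ψ Rc Zc p.1 p.2) (Icc a b ×ˢ Icc s₁ s₂))
    (hDc : ContinuousOn (fun p : ℝ × ℝ => D p.1 p.2) (Icc a b ×ˢ Icc s₁ s₂)) (hab : a ≤ b) (hs₁ : 0 < s₁) (hs : s₁ ≤ s₂)
    (hin : ∀ θ ∈ Icc a b, ∀ s, 0 < s → s ≤ s₁ → rayProfile ψ Rc Zc θ s < u)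
    (hmono : ∀ θ ∈ Icc a b, StrictMonoOn (rayProfile ψ Rc Zc θ) (Icc s₁ s₂))
    (hout : ∀ θ ∈ Icc a b, u < rayProfile ψ Rc Zc θ s₂)
    (hdlo : 0 < dlo) (hD : ∀ θ ∈ Icc a b, ∀ s ∈ Icc s₁ s₂, dlo ≤ D θ s ∧ D θ s ≤ dhi)
    (hRlo : 0 < Rlo) (hR : ∀ θ ∈ Icc a b, ∀ s ∈ Icc s₁ s₂, Rlo ≤ Rc + s * cos θ ∧ Rc + s * cos θ ≤ Rhi)
    (hr : 0 < r) (hrμ : η < r * μ) (hm : ∀ θ ∈ Icc a b, s₁ ≤ m θ - r ∧ m θ + r ≤ s₂)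
    (hres : ∀ θ ∈ Icc a b, |rayProfile ψ Rc Zc θ (m θ) - u| ≤ η)
    (hslope : ∀ θ ∈ Icc a b, ∀ s ∈ Icc (m θ - r) (m θ + r), HasDerivAt (rayProfile ψ Rc Zc θ) (D θ s) s ∧ μ ≤ D θ s)
    (hE : ∀ θ ∈ Icc a b, ∀ s ∈ Icc (m θ - r) (m θ + r), |polarKernel Rc D θ s - polarKernel Rc D θ (m θ)| ≤ E)
    (hmid : IntervalIntegrable (fun θ => polarKernel Rc D θ (m θ)) volume a b) :
    (∫ θ in a..b, polarKernel Rc D θ (m θ)) - E * (b - a) ≤ ∫ θ in a..b, polarIntegrand ψ Rc Zc u D θ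
      ∧ ∫ θ in a..b, polarIntegrand ψ Rc Zc u D θ ≤ (∫ θ in a..b, polarKernel Rc D θ (m θ)) + E * (b - a) := by
  have hsign : ∀ θ ∈ Icc a b, rayProfile ψ Rc Zc θ (m θ - r) < u ∧ u < rayProfile ψ Rc Zc θ (m θ + r) := fun θ hθ =>
    signs_of_residual_of_slope (F := rayProfile ψ Rc Zc θ) (F' := D θ) hr hrμ (hres θ hθ)
      (fun s hs' => (hslope θ hθ s hs').1) (fun s hs' => (hslope θ hθ s hs').2)
  exact panel_integral_midline hF hDc hab hs₁ hs hin hmono hout hdlo hD hRlo hR hr.le hm hsign hE hmid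

end tube

end PolarRay

end Summit.Ventures.FusionMHD.Models

end
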